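import Summits.BirchSwinnertonDyer.BirchSwinnertonDyer.Theses.UniversalToricDescent
import Summits.BirchSwinnertonDyer.BirchSwinnertonDyer.Theorems.UniversalToricDescentTwinAlgMuZeroAtThreeOfBetaRoadParam
import Summits.BirchSwinnertonDyer.BirchSwinnertonDyer.Theorems.UniversalToricDescentBetaRoadParamDefs
import Literature.NumberTheory.EllipticCurves.BertoliniDarmon2005.AdmissiblePrimes
import HarnessLib

/-!
# Crux r205 `TwinAlgMuZeroAtThree` (stmt-BirchSwinnertonDyer-24737) — node `bisigned-kolyvagin-primes` (crux-ideate g16, 2026-08-31)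

**THE MOVE (a Kolyvagin prime is a BI-SIGNED level-raising prime at `p = 3`; the sign selects an isotropic line, and the
symplectic reduction along it restores the Bertolini–Darmon admissible shape; the depth-one, Shimura-free fragment is a
`Λ`-adic Jochnowitz congruence in BOTH signs whose non-vanishing comes from Vatsal's theorem on a DEFINITE quaternion
algebra at the auxiliary inert prime).**

Let `ℓ` be a depth-one Kolyvagin prime of the twin `E′` (`ℓ ∤ 3N′`, `ℓ` inert in `K`, `Frob_ℓ ∼ τ` on `E′[3]`, i.e.
`3 ∣ ℓ + 1` and `3 ∣ a_ℓ(E′)`; `IsKolyvaginPrimeAtThree`).  Then `a_ℓ² ≡ (ℓ+1)²` is `0 ≡ 0 (mod 3)`, so Ribet's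
level-raising congruence holds for BOTH Steinberg signs `s = ±1`: `𝔪_s = (𝔪_{E′}, U_ℓ − s) ⊂ 𝕋(N′ℓ)` are both `ℓ`-new
(the degeneracy matrix `(ℓ+1, T_ℓ; T_ℓ, ℓ+1)` is `≡ 0 mod 𝔪`, so `J_old ∩ J_{ℓ-new} ⊇ J₀(N′)²[𝔪]`, on which
`U_ℓ ≡ (0, −1; −1, 0)` has both eigenvalues; `1 ≢ −1 (mod 3)` splits `𝕋^{(ℓ)}_𝔪 = 𝕋_{𝔪₊} × 𝕋_{𝔪₋}`).  The lineage
(g3 KEEPKILL «Taylor-admissible `q ≡ −1`: rank-two local cohomology — no classes», row 12 `rankTwo_of_sq_eq_one`,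
g8 dead lever 3, g53 item 4) and print (W. Zhang 2014 p. 226: "easier at an admissible prime since the local unramified
cohomology is of rank one"; Sweeting 2020 p. 10: `p ≥ 5` to avoid `q ≡ ±1`) dismiss these primes for bipartite use
because `H¹_unr(K_λ, E′[3])` has rank TWO.  §Instrument shows rank two is not an obstruction: with
`H := H¹(K_λ, E′[3]) = (unr ⊕ tame) ⊗ (L₊ ⊕ L₋)` (`L_±` the `Frob_ℓ`-eigenlines; `λ = ℓ𝓞_K` splits completely in
`K_∞`), the local Tate pairing pairs `unr⊗L_a` with `tame⊗L_b` iff `a ≠ b`; `fin = unr⊗(L₊⊕L₋)` and the Steinberg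
conditions `ord_s = (unr⊕tame)⊗L_{−s}` of the two level-raised forms `g_{ℓ,±}` are three Lagrangians with
`ord₊ ⊕ ord₋ = H`, `fin ∩ ord_s = unr⊗L_{−s}` a line, and the symplectic reduction
`W_s := (fin + ord_s)/(fin ∩ ord_s) = unr⊗L_s ⊕ tame⊗L_{−s}` — which IS Howard's `τ = s` eigenspace `V_s` — carries
`fin̄ ⋔ ord̄_s`, two isotropic lines in perfect duality: the BD-admissible `(1,1)` shape, for each sign, `τ`-equivariantly,
with odd parity jump `dim fin/(fin∩ord_s) = 1`.  So at `p = 3` the LEAD's own Chebotarev supply (Howard's Kolyvagin primes,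
tree: `Howard2004.exists_inert_prime_isArithFrobAt_conjGal_mul`) doubles as a supply of bi-admissible primes, two signs
each, with SIGN-ADAPTIVE steering (a class `c` with `loc_λ c ≠ 0` in `fin` has a non-zero `L_s`-component for some `s`).

Informal proof carried by the stubs (details in `Lines/bisigned_kolyvagin_primes.md`):
* (J) depth one, NO Shimura curves, NO multiplicity one, NO Ihara-at-3 for Shimura curves, NO explicit reciprocity law at
  `𝔭 ∣ 3`, NO Cornut–Vatsal in the indefinite setting: CM points of conductor `3^k` on `X₀(N′)` reduce at `λ` (`ℓ` inert)
  to supersingular points = Gross points on the definite algebra `B_{ℓ∞}` of level `N′`; `x ↦ (L_s-component of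
  red_λ π̄(x − x₀)) ∈ (E′(𝔽_{ℓ²})/3)_{L_s} ≅ 𝔽₃` is a mod-`3` Hecke eigenfunction `φ̄_s` on the supersingular set in the
  `𝔪_s`-eigenspace (`φ̄_s ∘ Frob = s·φ̄_s`), so the layer vectors `(v_s(red_λ P_k^σ))_{σ ∈ G_k}` ARE the mod-`3` theta
  elements `θ̄_k(φ̄_s) ∈ 𝔽₃[G_k]` of the bi-signed level-raised forms `g_{ℓ,s}` (Jochnowitz congruence: BD99 §§3–5 for
  `p ∤ 2N·deg π`, one sign; Vatsal 2003 §§6–7 with descent prime `≠` tower prime, BOTH eigenlines `V_±`); Vatsal's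
  Ratner argument on the definite set gives `μ(θ̄(φ̄)) = 0` for every non-Eisenstein `φ̄` (no multiplicity one needed);
  hence for EVERY Kolyvagin `ℓ` (and both `s`) the principal layer Heegner points are NOT locally `3`-divisible at
  primes above `λ` for `k ≫ 0` — stub `KolyvaginLocalIndivisibleMultAtThree` (typed binder-for-binder as K1‴ with
  `decomp 𝔭`, `𝔭 ∣ 3`, replaced by a conjugate of `decomp λ`, `λ ∣ ℓ` a Kolyvagin prime).  PROVED here:
  supply + (J) ⟹ (G)‴ (global residual indivisibility, row 8's leaf flagged F-CV-3N) — `global_of_kolyvaginLocal`.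
* (E) the full engine: the signed bipartite Euler system `{κ(m,s), θ(m,s)}` indexed by square-free products of Kolyvagin
  primes WITH signs (`m` even: Heegner classes on `X₀(N′)` / Shimura curves `X_{N′;m}`; `m` odd: Gross points on
  `B_{m∞}`), first law `v_s(κ(m))|_λ = θ(mℓ,s)` (supersingular reduction), second law `∂_s κ(mℓ,s) = θ(m,s)`
  (Čerednik–Drinfeld at `ℓ`), rigidity = Howard 2006 Thm. 3.2.3 run on signed prime data over `Λ/3ⁿ` (or `Ω = Λ/3`,
  where depth `n = 1` suffices) ⟹ K2♭ (`HowardConclusionOfFamilyMultAtThree`, row 12's engine-agnostic slot, verbatim)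
  — stub `stub_bisignedBipartiteHowardConclusion`; its hard leaf (multiplicity one / Ihara for the Shimura curves
  `X_{N′;ℓ₁ℓ₂}` at `p = 3`) is SHARED with row 12 and declared, not hidden.
* K1‴ (`(β)`, local indivisibility at `𝔭 ∣ 3`) stays BY NAME: the crux's relaxed corner needs it for the local term
  `2μ(H¹_ord(K_𝔭′,𝕋)/loc 𝔖_∞)`; C₀ BY NAME (the signed frame; the bi-signed primes exist there verbatim, the definite
  theta elements of the non-ordinary `g_{ℓ,s}` (`a₃ ∈ {0, ±3}`) are Darmon–Iovita/Sprung-type — not typed here).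

**PIECES and TAGS (D-0171).**
* §Instrument (`BisignedLocalSymplectic`, `frobShape_*`, `card_tauClass_gl2_f3`) — PROVED (`decide`); INSTRUMENT data.
* `KolyvaginPrimeSupplyAtThree` (S1) — KNOWN (Čebotarev in `K(E′[3])/ℚ`, class of `τ`, density `1/8`); WEAKER than the
  crux; Leaf: ATTACKABLE from `Automorphic.chebotarev_artinRep_holds` / `Howard2004.exists_inert_prime_isArithFrobAt_conjGal_mul`
  + the dictionary `tr ρ̄₃(Frob_ℓ) = a_ℓ mod 3`, `det = ℓ mod 3`.
* `KolyvaginLocalIndivisibleMultAtThree` (J = S3′) — UNDECIDED·research-port (three leaves: bi-signed Ribet raising at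
  `3 ∥ N′` très ramifié = port; `φ̄_s ≠ 0` = Ihara for `X₀(N′)` at `3` = port; Vatsal `μ = 0` on the definite set of level
  `N′` with `3 ∥ N′` = port-UNDECIDED); WEAKER than K1‴-at-`λ`-type statements, NOT implied by the crux, implies (G)‴
  given S1 (PROVED); Leaf: ATTACKABLE (L) + INSTRUMENTABLE (15a1/ℚ(√−11), smallest Kolyvagin `ℓ`: is `y_K` or `z_1`
  locally `3`-divisible at `λ`? both `L_±`-components over the first layers — PARI/Magma, kit = 0, flag F-g16-JOCH).
* `HowardConclusionOfFamilyMultAtThree` (K2♭) — verbatim row 12 / beta-road slot; UNDECIDED; reached here by (E):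
  Leaf IDEA-NEEDED (Shimura-curve multiplicity one / Ihara at `p = 3`, shared with row 12) — COSTUME-adjacent only in the
  sense that K2♭ is the common engine slot; the engine inputs (S0, S1, J) are typed and differ from row 12's (U2, U1).
* `GlobalHeegnerIndivisibleMultOfParamAtThree` ((G)‴) — verbatim row 8's piece; DERIVED here (`global_of_kolyvaginLocal`).
* K1‴, C₀′ — BY NAME from beta-road v19 (shared leaves), as in rows 12/17/18/21/23/24.

**DISPROOF USED.** `Disproof.lean` (2026-08-29, NO KILL): honours `twinAlgMuZeroAtThree_false_without_heegner` — the
Heegner hypothesis is load-bearing in (J) (CM points on `X₀(N′)` exist; `ℓ` inert makes their reduction supersingular;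
`ε`-bookkeeping of the definite/indefinite alternation) and in K1‴; no stub is an instance of `Negative/GuardCuts`
(`not_bucketGuard_11a1`, `exists_heegner_split_not_odd`): every stub keeps the bucket guard and `Odd d_K` where the crux
has them; habitats 15a1/ℚ(√−11) (B), 17a1/ℚ(√−35) (C₀) are instances.  Negatives 24881 / 15532 unrelated.
Barrier `NoAdmissiblePrimesAtThree`: a Kolyvagin prime is not BD-admissible (`kolyvaginPrime_not_admissible`, from the
tree's `not_isAdmissiblePrime_three`) — the node works OUTSIDE the empty admissible set, restoring rank `(1,1)` by
symplectic reduction instead of by clause (3).  BANNED option `allowUnsafeReducibility` not used.  `sorry` ONLY inside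
the five `stub_*`; `TwinAlgMuZeroAtThree_of` concludes the crux BY NAME.
-/

set_option linter.dupNamespace false
set_option autoImplicit false

/-! ## Instrument (kernel-checked by `decide`): the bi-signed local symplectic structure at a Kolyvagin prime, `n = 1`.
Model: `H¹(K_λ, E′[3]) = (unr ⊕ tame) ⊗ (L₊ ⊕ L₋)` with coordinates `v 0 = u₊`, `v 1 = u₋`, `v 2 = t₊`, `v 3 = t₋`
(`u_a = unr ⊗ e_a`, `t_a = tame ⊗ e_a`, `e_± ∈ L_±` with Weil pairing `e(e₊,e₋) = 1`); local Tate pairing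
`⟨x ⊗ P, y ⊗ Q⟩ = (x ∪ y)·e(P,Q)` with `unr ∪ tame = 1`, `unr ∪ unr = tame ∪ tame = 0`: Gram form `B` below
(symmetric: `(y∪x)e(Q,P) = (−x∪y)(−e(P,Q))`).  `τ` acts by `+1` on `unr` (`τ Frob_λ τ = Frob_λ`), `−1` on `tame`
(`τ` inverts `μ`), `a` on `L_a`: `τ = diag(1,−1,−1,1)`. -/

namespace Summit.BirchSwinnertonDyer.BirchSwinnertonDyer.Cruxes.TwinAlgMuZeroAtThree.BisignedKolyvaginPrimes.Instrument

/-- The local Tate pairing in the model coordinates. -/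
def B (v w : Fin 4 → ZMod 3) : ZMod 3 := v 0 * w 3 + v 3 * w 0 - v 1 * w 2 - v 2 * w 1

/-- `fin = H¹_unr(K_λ, E′[3]) = unr ⊗ (L₊ ⊕ L₋)`. -/
def fin (v : Fin 4 → ZMod 3) : Prop := v 2 = 0 ∧ v 3 = 0
/-- `ord₊ = im H¹(K_λ, F⁺(g_{ℓ,+})) = (unr ⊕ tame) ⊗ L₋` (Steinberg sign `s = +1`: `F⁺ ≡ L_{−s}`). -/
def ordPlus (v : Fin 4 → ZMod 3) : Prop := v 0 = 0 ∧ v 2 = 0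
/-- `ord₋ = (unr ⊕ tame) ⊗ L₊` (Steinberg sign `s = −1`). -/
def ordMinus (v : Fin 4 → ZMod 3) : Prop := v 1 = 0 ∧ v 3 = 0
/-- Complex conjugation on the model. -/
def tau (v : Fin 4 → ZMod 3) : Fin 4 → ZMod 3 := ![v 0, -v 1, -v 2, v 3]
/-- `u₋ = unr ⊗ e₋` (spans `fin ∩ ord₊`), `u₊ = unr ⊗ e₊`, `t₋ = tame ⊗ e₋`. -/
def uMinus : Fin 4 → ZMod 3 := ![0, 1, 0, 0]
def uPlus : Fin 4 → ZMod 3 := ![1, 0, 0, 0]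
def tMinus : Fin 4 → ZMod 3 := ![0, 0, 0, 1]

instance (v : Fin 4 → ZMod 3) : Decidable (fin v) := inferInstanceAs (Decidable (_ ∧ _))
instance (v : Fin 4 → ZMod 3) : Decidable (ordPlus v) := inferInstanceAs (Decidable (_ ∧ _))
instance (v : Fin 4 → ZMod 3) : Decidable (ordMinus v) := inferInstanceAs (Decidable (_ ∧ _))

set_option maxRecDepth 40000

/-- `B` is symmetric and non-degenerate. -/
theorem B_symm_nondeg :
    (∀ v w : Fin 4 → ZMod 3, B v w = B w v) ∧ (∀ v : Fin 4 → ZMod 3, (∀ w, B v w = 0) → v = 0) := by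
  constructor <;> decide

/-- `fin` is Lagrangian (isotropic and equal to its own orthogonal). -/
theorem fin_lagrangian :
    (∀ v w : Fin 4 → ZMod 3, fin v → fin w → B v w = 0) ∧
      (∀ v : Fin 4 → ZMod 3, (∀ w, fin w → B v w = 0) → fin v) := by
  constructor <;> decide

/-- `ord₊` and `ord₋` are Lagrangian. -/
theorem ord_lagrangian :
    (∀ v w : Fin 4 → ZMod 3, ordPlus v → ordPlus w → B v w = 0) ∧
      (∀ v : Fin 4 → ZMod 3, (∀ w, ordPlus w → B v w = 0) → ordPlus v) ∧
    (∀ v w : Fin 4 → ZMod 3, ordMinus v → ordMinus w → B v w = 0) ∧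
      (∀ v : Fin 4 → ZMod 3, (∀ w, ordMinus w → B v w = 0) → ordMinus v) := by
  refine ⟨?_, ?_, ?_, ?_⟩ <;> decide

/-- The two signed ordinary conditions are TRANSVERSE: `ord₊ ∩ ord₋ = 0` (so `ord₊ ⊕ ord₋ = H`). -/
theorem ordPlus_inf_ordMinus : ∀ v : Fin 4 → ZMod 3, ordPlus v → ordMinus v → v = 0 := by
  decide

/-- `fin ∩ ord₊` is the LINE spanned by `u₋ = unr ⊗ e₋` (rank one, not zero and not rank two). -/
theorem fin_inf_ordPlus_line : ∀ v : Fin 4 → ZMod 3, (fin v ∧ ordPlus v) ↔ ∃ a : ZMod 3, v = a • uMinus := by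
  decide

/-- `(fin ∩ ord₊)^⊥ = fin + ord₊` (both directions), so `W₊ := (fin + ord₊)/(fin ∩ ord₊)` is a non-degenerate plane. -/
theorem perp_line_eq_fin_sup_ordPlus :
    (∀ v : Fin 4 → ZMod 3, B uMinus v = 0 → ∃ a : Fin 4 → ZMod 3, fin a ∧ ordPlus (v - a)) ∧
      (∀ a b : Fin 4 → ZMod 3, fin a → ordPlus b → B uMinus (a + b) = 0) := by
  constructor <;> decide

/-- The symplectic reduction `W₊` has coordinates `(v 0, v 3) = ⟨u₊, t₋⟩`; it IS the `τ = +1` eigenspace `V₊`;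
the images `fin̄ = ⟨u₊⟩` and `ord̄₊ = ⟨t₋⟩` are isotropic lines in perfect duality — the BD-admissible `(1,1)` shape. -/
theorem reduction_admissible_shape :
    (∀ v : Fin 4 → ZMod 3, tau v = v ↔ (v 1 = 0 ∧ v 2 = 0)) ∧
      B uPlus uPlus = 0 ∧ B tMinus tMinus = 0 ∧ B uPlus tMinus = 1 ∧ fin uPlus ∧ ordPlus tMinus ∧
      ¬ ordPlus uPlus ∧ ¬ fin tMinus := by
  refine ⟨?_, ?_, ?_, ?_, ?_, ?_, ?_, ?_⟩ <;> decide

/-- `τ` preserves the pairing and the three Lagrangians (everything is `τ`-equivariant, as Howard's and BD's axioms need). -/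
theorem tau_compat :
    (∀ v w : Fin 4 → ZMod 3, B (tau v) (tau w) = B v w) ∧ (∀ v : Fin 4 → ZMod 3, fin v → fin (tau v)) ∧
      (∀ v : Fin 4 → ZMod 3, ordPlus v → ordPlus (tau v)) ∧ (∀ v : Fin 4 → ZMod 3, ordMinus v → ordMinus (tau v)) := by
  refine ⟨?_, ?_, ?_, ?_⟩ <;> decide

/-- Parity jump is ODD: `fin/(fin ∩ ord₊)` is a line (`fin` has `9` elements, `fin ∩ ord₊` has `3`). -/
theorem parity_jump_odd :
    (Finset.univ.filter (fun v : Fin 4 → ZMod 3 => fin v)).card = 9 ∧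
      (Finset.univ.filter (fun v : Fin 4 → ZMod 3 => fin v ∧ ordPlus v)).card = 3 := by
  constructor <;> decide

/-- SIGN-ADAPTIVE STEERING: a non-zero finite class has a non-zero `L_s`-component for some sign `s`. -/
theorem steering : ∀ v : Fin 4 → ZMod 3, fin v → v ≠ 0 → (v 0 ≠ 0 ∨ v 1 ≠ 0) := by
  decide

/-- Frobenius shape: in `M₂(𝔽₃)`, `det F = −1 ∧ tr F = 0` (i.e. `ℓ ≡ −1`, `a_ℓ ≡ 0 (mod 3)`) iff `F² = 1 ∧ F ≠ ±1`
(the conjugacy class of `ρ̄₃(τ)`); such `F` has both eigenlines `L₊`, `L₋`. -/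
theorem frobShape_iff :
    ∀ F : Matrix (Fin 2) (Fin 2) (ZMod 3),
      (F.det = -1 ∧ F.trace = 0) ↔ (F ^ 2 = 1 ∧ F ≠ 1 ∧ F ≠ -1) := by
  decide

theorem frobShape_eigenlines :
    ∀ F : Matrix (Fin 2) (Fin 2) (ZMod 3), F.det = -1 → F.trace = 0 →
      (∃ v : Fin 2 → ZMod 3, v ≠ 0 ∧ F.mulVec v = v) ∧ (∃ w : Fin 2 → ZMod 3, w ≠ 0 ∧ F.mulVec w = -w) := by
  decide

/-- The class of `τ` in `GL₂(𝔽₃)` has `12` elements (density `12/48 · 1/2 = 1/8` of rational primes are depth-one Kolyvagin primes). -/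
theorem card_tauClass_gl2_f3 :
    (Finset.univ.filter (fun F : Matrix (Fin 2) (Fin 2) (ZMod 3) => F.det = -1 ∧ F.trace = 0)).card = 12 := by
  decide

/-- The instrument facts of §Instrument bundled as one Prop (S0 = the bi-signed local lemma at `n = 1`): symmetric
non-degenerate pairing; `fin`, `ord₊`, `ord₋` Lagrangian; `ord₊ ∩ ord₋ = 0`; `fin ∩ ord₊` a line with
`(fin ∩ ord₊)^⊥ = fin + ord₊`; the reduction `W₊ = V₊` has the admissible `(1,1)` shape; `τ`-compatibility; odd parity
jump; sign-adaptive steering.  PROVED (`bisignedLocalSymplectic`).  (The `s = −1` statements are the images under the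
symmetry `L₊ ↔ L₋`.) -/
def BisignedLocalSymplectic : Prop :=
  ((∀ v w : Fin 4 → ZMod 3, B v w = B w v) ∧
      (∀ v : Fin 4 → ZMod 3, (∀ w, B v w = 0) → v = 0)) ∧
  ((∀ v w : Fin 4 → ZMod 3, fin v → fin w → B v w = 0) ∧
      (∀ v : Fin 4 → ZMod 3, (∀ w, fin w → B v w = 0) → fin v)) ∧
  ((∀ v w : Fin 4 → ZMod 3, ordPlus v → ordPlus w → B v w = 0) ∧
      (∀ v : Fin 4 → ZMod 3, (∀ w, ordPlus w → B v w = 0) → ordPlus v) ∧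
    (∀ v w : Fin 4 → ZMod 3, ordMinus v → ordMinus w → B v w = 0) ∧
      (∀ v : Fin 4 → ZMod 3, (∀ w, ordMinus w → B v w = 0) → ordMinus v)) ∧
  (∀ v : Fin 4 → ZMod 3, ordPlus v → ordMinus v → v = 0) ∧
  (∀ v : Fin 4 → ZMod 3, (fin v ∧ ordPlus v) ↔ ∃ a : ZMod 3, v = a • uMinus) ∧
  ((∀ v : Fin 4 → ZMod 3, B uMinus v = 0 →
      ∃ a : Fin 4 → ZMod 3, fin a ∧ ordPlus (v - a)) ∧
    (∀ a b : Fin 4 → ZMod 3, fin a → ordPlus b → B uMinus (a + b) = 0)) ∧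
  ((∀ v : Fin 4 → ZMod 3, tau v = v ↔ (v 1 = 0 ∧ v 2 = 0)) ∧
      B uPlus uPlus = 0 ∧ B tMinus tMinus = 0 ∧
      B uPlus tMinus = 1 ∧ fin uPlus ∧
      ordPlus tMinus ∧ ¬ ordPlus uPlus ∧ ¬ fin tMinus) ∧
  ((∀ v w : Fin 4 → ZMod 3, B (tau v) (tau w) = B v w) ∧
      (∀ v : Fin 4 → ZMod 3, fin v → fin (tau v)) ∧
      (∀ v : Fin 4 → ZMod 3, ordPlus v → ordPlus (tau v)) ∧
      (∀ v : Fin 4 → ZMod 3, ordMinus v → ordMinus (tau v))) ∧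
  ((Finset.univ.filter (fun v : Fin 4 → ZMod 3 => fin v)).card = 9 ∧
      (Finset.univ.filter (fun v : Fin 4 → ZMod 3 => fin v ∧ ordPlus v)).card = 3) ∧
  (∀ v : Fin 4 → ZMod 3, fin v → v ≠ 0 → (v 0 ≠ 0 ∨ v 1 ≠ 0))

/-- S0 is a theorem (kernel-checked in §Instrument by `decide`). -/
theorem bisignedLocalSymplectic : BisignedLocalSymplectic :=
  ⟨B_symm_nondeg, fin_lagrangian, ord_lagrangian, ordPlus_inf_ordMinus,
    fin_inf_ordPlus_line, perp_line_eq_fin_sup_ordPlus, reduction_admissible_shape,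
    tau_compat, parity_jump_odd, steering⟩

end Summit.BirchSwinnertonDyer.BirchSwinnertonDyer.Cruxes.TwinAlgMuZeroAtThree.BisignedKolyvaginPrimes.Instrument

noncomputable section

open scoped Classical Pointwise ContRepresentation TensorProduct NumberField

namespace Summit.BirchSwinnertonDyer.BirchSwinnertonDyer.Cruxes.TwinAlgMuZeroAtThree.BisignedKolyvaginPrimes

open NumberField IsDedekindDomain Field WeierstrassCurve
open Literature.NumberTheory.EllipticCurves Literature.NumberTheory.EllipticCurves.GreenbergSelmer
  Literature.NumberTheory.EllipticCurves.IwasawaAlgebra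
open Summit.BirchSwinnertonDyer.Rank1Residual.X11b Summit.BirchSwinnertonDyer.Rank1Residual.X11b.AcSelmer
open Summit.BirchSwinnertonDyer.BirchSwinnertonDyer.Theorems.UniversalToricDescentAcDualMuZero
open Summit.BirchSwinnertonDyer.BirchSwinnertonDyer.Theorems
open Summit.BirchSwinnertonDyer.BirchSwinnertonDyer.Theorems.UniversalToricDescentTwinAlgMuZeroAtThreeOfBetaRoad
open Summit.BirchSwinnertonDyer.BirchSwinnertonDyer.Theorems.UniversalToricDescentTwinAlgMuZeroAtThreeOfBetaRoadParam
open Literature.NumberTheory.EllipticCurves.ZpExtension Literature.NumberTheory.EllipticCurves.Castella2024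
open Summit.BirchSwinnertonDyer.BirchSwinnertonDyer.Theorems.UniversalToricDescentStrictPlace
open Summit.BirchSwinnertonDyer.BirchSwinnertonDyer.Theorems.UniversalToricDescentTowerTorsion
open Literature.NumberTheory.EllipticCurves.ModularForms (ModularParametrizationData heegnerPointComplexOfConductor)
open Literature Literature.NumberTheory.GaloisCohomology Literature.NumberTheory.GaloisCohomology.Howard2004
open Literature.NumberTheory.GaloisRepresentations Literature.NumberTheory.GaloisRepresentations.DiscreteGaloisModule

/-! ## 0. The new object: depth-one Kolyvagin primes as bi-signed level-raising primes at `p = 3` -/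

/-- **Depth-one Kolyvagin prime at `p = 3`** for the twin `W′` of conductor `N` and the imaginary quadratic `K`: `ℓ` prime,
`ℓ ∤ 3N`, `ℓ` inert in `K`, and `ρ̄₃(Frob_ℓ)` in the class of complex conjugation — arithmetically `3 ∣ ℓ + 1` (`det = −1`)
and `3 ∣ a_ℓ` (`tr = 0`), which by `Instrument.frobShape_iff` is `F² = 1, F ≠ ±1`.  For such `ℓ`, `a_ℓ² ≡ (ℓ+1)² (mod 3)`
(both sides `≡ 0`): Ribet's level-raising congruence holds for BOTH signs `a_ℓ(g) = ±1`.
[cite: Howard2004HeegnerKolyvagin, §1.6 Lemma 1.6.2 (Kolyvagin primes, shape)] [cite: BertoliniDarmon1999Jochnowitz, §3 (Kolyvagin prime `q`, `p ∣ q+1, a_q`)] -/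
def IsKolyvaginPrimeAtThree (N : ℕ) (K : Type) [Field K] [NumberField K] (W' : WeierstrassCurve ℚ)
    [W'.IsGloballyMinimal] (ℓ : ℕ) : Prop :=
  ℓ.Prime ∧ ¬ ℓ ∣ 3 * N ∧ (Ideal.span {(ℓ : 𝓞 K)}).IsPrime ∧ (3 : ℤ) ∣ (ℓ : ℤ) + 1 ∧ (3 : ℤ) ∣ W'.frobeniusTrace ℓ

/-- Barrier placement: a Kolyvagin prime (indeed any prime) is NOT BD-admissible at `p = 3` — this node lives outside the
(empty) admissible set of `NoAdmissiblePrimesAtThree` and restores the rank-`(1,1)` shape by the symplectic reduction of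
§Instrument instead of by BD05's clause (3). [cite: BertoliniDarmon2005, p. 18 (Admissible primes) (3)] -/
theorem kolyvaginPrime_not_admissible (N : ℕ) (K : Type) [Field K] (a : ℕ → ℤ) (m ℓ : ℕ) :
    ¬ BertoliniDarmon2005.IsAdmissiblePrime N K a 3 m ℓ :=
  BertoliniDarmon2005.not_isAdmissiblePrime_three ℓ

/-! ## 1. The stubs -/

/-- **S1 · `KolyvaginPrimeSupplyAtThree`** — for a globally minimal `W′/ℚ` with `ρ̄₃` onto `GL₂(𝔽₃)` and conductor `N′`,
and an imaginary quadratic `K` with a degree-one prime above `3` (so `3` splits and `K ≠ ℚ(√−3) = ℚ(E′[3]) ∩ ℝ-free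
quadratic subfield`, whence `Gal(K(E′[3])/ℚ) = Gal(K/ℚ) × GL₂(𝔽₃)`), there are depth-one Kolyvagin primes beyond every
bound (Čebotarev applied to the class of `τ`, density `1/8`; `Instrument.card_tauClass_gl2_f3`).  KNOWN; WEAKER than the
crux; ATTACKABLE from the tree's `Howard2004.exists_inert_prime_isArithFrobAt_conjGal_mul` plus `tr ρ̄₃(Frob_ℓ) ≡ a_ℓ`,
`det ≡ ℓ (mod 3)`. [cite: Howard2004HeegnerKolyvagin, Lemma 1.6.2 (arXiv 2.6.2)] -/
def KolyvaginPrimeSupplyAtThree : Prop :=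
  ∀ (W' : WeierstrassCurve ℚ) [W'.IsElliptic] [W'.IsGloballyMinimal] (N' : ℕ) (K : Type) [Field K] [NumberField K],
    W'.HasSurjectiveModNGaloisRep 3 → W'.conductorNorm ℤ = N' → IsImaginaryQuadratic K →
    ∀ (𝔭 : HeightOneSpectrum (𝓞 K)), ((3 : ℕ) : 𝓞 K) ∈ 𝔭.asIdeal →
      𝔭.asIdeal.ramificationIdx (𝓞 ℚ) = 1 → 𝔭.asIdeal.inertiaDeg (𝓞 ℚ) = 1 →
    ∀ b : ℕ, ∃ ℓ : ℕ, b < ℓ ∧ IsKolyvaginPrimeAtThree N' K W' ℓ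

/-- **stub_kolyvaginSupply** (S1; KNOWN / ATTACKABLE; INSTRUMENTABLE on any bucket-B twin: for 15a1 and `K = ℚ(√−11)` the
primes `ℓ ≡ 2 (mod 3)`, inert in `K`, with `3 ∣ a_ℓ`). [cite: Howard2004HeegnerKolyvagin, Lemma 1.6.2] -/
theorem stub_kolyvaginSupply : KolyvaginPrimeSupplyAtThree := by
  sorry

/-- **J · `KolyvaginLocalIndivisibleMultAtThree`** — the OUTPUT of the depth-one bi-signed `Λ`-adic Jochnowitz congruence +
Vatsal's `μ = 0` on the definite set: for every bucket-B twin frame (binders verbatim K1‴ =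
`UniversalToricDescentBetaRoadParamDefs.PrincipalHeegnerIndivisibleMultOfParamAtThree`, minus the prime `𝔭 ∣ 3`), every
depth-one Kolyvagin prime `ℓ` and the prime `w = ℓ𝓞_K` of `K` above it, there are a layer `k`, a Heegner point `x` of
conductor `3^{k+1}`, a transversal `R` (so `∑_{r∈R} r • x` is the principal layer-`k` Heegner point) and a conjugate
`g D_w g⁻¹` of the decomposition group such that `3 • P ≠ ∑ r • x` for every `P` fixed by `Γ_{K_k} ⊓ g D_w g⁻¹` — the
layer Heegner point is not `3`-divisible LOCALLY at (some prime of `K_k` above) `w`.  Mechanism (module docstring (J)):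
the `L_s`-components of `red_w` of the layer points are the mod-`3` theta elements of the bi-signed level-raised forms
`g_{ℓ,±}`, and Vatsal's theorem makes those non-zero for `k ≫ 0`.  UNDECIDED·research-port; NOT implied by the crux;
implies (G)‴ (`global_of_kolyvaginLocal`).  Why it might fail: Vatsal's equidistribution at Eichler level `3 ∥ N′` at the
tower prime, and `φ̄_s ≠ 0` (Ihara for `X₀(N′)` mod `3` with `3 ∥ N′`), are ports, not citations.
[cite: BertoliniDarmon1999Jochnowitz, §5 (first Jochnowitz congruence, `p ∤ 2N·deg π`)] [cite: Vatsal2003SpecialValues, Thm. 1.2, Thm. 1.4, §6 (both eigenlines `V_±`; descent prime `≠ p`)] -/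
@[conjecture]
def KolyvaginLocalIndivisibleMultAtThree : Prop :=
  ∀ (W' : WeierstrassCurve ℚ) [W'.IsElliptic] [W'.IsGloballyMinimal] (N' : ℕ) [NeZero N']
    (K : Type) [Field K] [NumberField K] (_Dt' : ModularParametrizationData W' N'),
    Rank1Residual.Mult W' 3 → ¬ 3 ∣ padicValInt 3 W'.minimalDiscriminantInt →
    W'.HasSurjectiveModNGaloisRep 3 → W'.conductorNorm ℤ = N' → IsImaginaryQuadratic K →
    SatisfiesHeegnerHypothesis N' K → Odd (NumberField.discr K) →
    ∀ (κ : ZpExtension K 3), κ.IsAnticyclotomic →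
    ∀ (ℓ : ℕ), IsKolyvaginPrimeAtThree N' K W' ℓ →
    ∀ (w : HeightOneSpectrum (𝓞 K)), (ℓ : 𝓞 K) ∈ w.asIdeal →
    ∃ (jbar : AlgebraicClosure K →+* ℂ) (Dt : ModularParametrizationData W' N') (β : ℤ)
      (_ : (4 * N' : ℤ) ∣ β ^ 2 - NumberField.discr K) (k : ℕ)
      (x : geomPoints (W'.baseChange K)) (R : Finset (absoluteGaloisGroup K)) (g : absoluteGaloisGroup K),
      complexPoint W' jbar x = heegnerPointComplexOfConductor Dt (NumberField.discr K) β (3 ^ (k + 1)) ∧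
      (↑R ⊆ (κ.layerSubgroup k : Set (absoluteGaloisGroup K))) ∧
      (∀ τ ∈ κ.layerSubgroup k, ∃! r, r ∈ R ∧ r⁻¹ * τ ∈ ringClassSubgroup K (3 ^ (k + 1)) jbar) ∧
      ∀ (P : geomPoints (W'.baseChange K)),
        (∀ σ ∈ κ.layerSubgroup k ⊓ (decomp w).map (MulAut.conj g).toMonoidHom, σ • P = P) →
        (3 : ℤ) • P ≠ ∑ r ∈ R, r • x

/-- **stub_bisignedJochnowitzLocal** (J; UNDECIDED·research-port, size L; the node's NEW typed research statement).
[cite: BertoliniDarmon1999Jochnowitz, §5] [cite: Vatsal2003SpecialValues, Thm. 1.2, §§6–7] -/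
theorem stub_bisignedJochnowitzLocal : KolyvaginLocalIndivisibleMultAtThree := by
  sorry

/-- **K2♭ · `HowardConclusionOfFamilyMultAtThree`** — VERBATIM the engine-agnostic slot of node `unipotent_bipartite` (row 12)
= beta-road's K2 conclusion type without its Kolyvagin-system hypothesis: for every bucket-B twin frame and every
norm-compatible Heegner family `F` with K1's local indivisibility at one degree-one `𝔭 ∋ 3`, the `Λ`-adic datum `Dat`, the
`Λ`-adic Heegner class `z` of `F`, and Howard's `Conclusion` at the control levels of `z`.  Any rank-one rigidity engine
targets this; here the signed bipartite engine (E). [cite: Howard2004HeegnerKolyvagin, Thm. 1.6.1 (conclusion shape)] -/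
def HowardConclusionOfFamilyMultAtThree : Prop :=
  ∀ (W' : WeierstrassCurve ℚ) [W'.IsElliptic] [W'.IsGloballyMinimal] (N' : ℕ) [NeZero N']
    (K : Type) [Field K] [NumberField K],
    Rank1Residual.Mult W' 3 → ¬ 3 ∣ padicValInt 3 W'.minimalDiscriminantInt →
    ∀ (hsurj : W'.HasSurjectiveModNGaloisRep 3), W'.conductorNorm ℤ = N' → ∀ (hK : IsImaginaryQuadratic K),
    SatisfiesHeegnerHypothesis N' K → Odd (NumberField.discr K) →
    ∀ (κ : ZpExtension K 3), κ.IsAnticyclotomic →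
    ∀ (γ : absoluteGaloisGroup K) [hγ : Fact (κ.IsTopGenerator γ)]
      (𝔭 : HeightOneSpectrum (𝓞 K)), ((3 : ℕ) : 𝓞 K) ∈ 𝔭.asIdeal →
      𝔭.asIdeal.ramificationIdx (𝓞 ℚ) = 1 → 𝔭.asIdeal.inertiaDeg (𝓞 ℚ) = 1 →
    ∀ (jbar : AlgebraicClosure K →+* ℂ) (F : HeegnerFamily N' W' K κ jbar) (α : ℤ),
      α ^ 2 = 1 → F.IsNormCompatible γ α →
      (∃ k : ℕ, ∀ (Q : geomPoints (W'.baseChange K))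
        (hQ : ∀ σ ∈ κ.layerSubgroup k ⊓ decomp 𝔭, σ • ((3 : ℤ) • Q) = (3 : ℤ) • Q),
        (3 : ℤ) • Q = F.z k →
          (W'.baseChange K).kummerClassOver (κ.layerSubgroup k ⊓ decomp 𝔭) 3 Q hQ ≠ 0) →
    ∃ (Dat : (W'.baseChange K).LambdaAdicSelmerData κ γ) (z : Dat.S),
      IsLambdaAdicHeegnerClass Dat F α z ∧
      UniversalToricDescentTwinHowardConclusion.Stmt.conclusionAtControlLevels 3 N' W' K κ γ
        hγ.out (baseChange_noPTorsion_of_surjective W' 3 hsurj K hK) Dat z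

/-- **stub_bisignedBipartiteHowardConclusion** (E; UNDECIDED / IDEA-NEEDED — the research constant of this node, HARDEST):
the bi-signed local structure (S0), the Kolyvagin supply (S1) and the depth-one Jochnowitz non-vanishing (J) feed a
SIGNED bipartite Euler system at `p = 3`, `3 ∥ N′` — classes `κ(m,s)` from `X₀(N′)` and the Shimura curves `X_{N′;m}`
(`m` an even product of Kolyvagin primes with signs `s`), theta elements `θ(m,s)` from Gross points on `B_{m∞}` (`m` odd),
ordinary conditions `ord_{s(q)}` at `q ∣ m`, first/second reciprocity laws by supersingular reduction / Čerednik–Drinfeld —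
whose rigidity (Howard 2006 Thm. 3.2.3 on signed prime data over `Λ/3ⁿ`) yields K2♭.  Leaves: (E1) multiplicity one /
Ihara for `X_{N′;ℓ₁ℓ₂}` at `p = 3` (SHARED with row 12; DT94 need `p ≥ 5`) — IDEA-NEEDED; (E2) the second law at a
bi-signed prime (component group `(Φ_ℓ)_{𝔪_s}` free of rank one when `3 ∣ ℓ + 1`) — UNDECIDED; (E3) hypothesis (CR)
(`ρ̄` ramified at `r ∥ N′`) is not among the crux binders.
[cite: Howard2006Bipartite, Thm. 3.2.3 (shape)] [cite: BertoliniDarmon2005, Thm. 4.1, Thm. 4.2 (the two laws, `p ∤ ℓ²−1`)] [cite: BurungaleCastellaKim2021, Thm. 4.1 (bipartite system in the Heegner setting, `p ≥ 5`)] -/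
theorem stub_bisignedBipartiteHowardConclusion :
    Instrument.BisignedLocalSymplectic → KolyvaginPrimeSupplyAtThree → KolyvaginLocalIndivisibleMultAtThree →
      HowardConclusionOfFamilyMultAtThree := by
  sorry

/-- **stub_principalHeegnerIndivisibleMult** (K1‴ = (β), BY NAME from beta_road v19; RESEARCH, instrument-decidable per instance).
[cite: Castella2024, §2.2 and Thm. 2.1] [cite: BertoliniDarmon1996, §2.5] -/
theorem stub_principalHeegnerIndivisibleMult :
    UniversalToricDescentBetaRoadParamDefs.PrincipalHeegnerIndivisibleMultOfParamAtThree := by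
  sorry

/-- **stub_goodSS** (C₀′, BY NAME from beta_road v19; the signed frame).
[cite: BurungaleCastellaSkinner2025, Thm. 4.2.1 (b), Prop. 4.2.2 (shape only)] -/
theorem stub_goodSS :
    UniversalToricDescentBetaRoadParamDefs.TwinAlgMuZeroAtThreeGoodSSOfParam := by
  sorry

/-! ## 2. Evidence for the tags and the composition (sorry-free below this line) -/

/-- **(G)‴** — VERBATIM row 8's `FineSelmerCut.GlobalHeegnerIndivisibleMultOfParamAtThree` (= K1‴ with `Γ_{K_k} ⊓ D_𝔭`
replaced by `Γ_{K_k}`): one principal layer Heegner point is not `3`·(a `K_k`-rational point).  Restated here so that the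
edge J ⟹ (G)‴ is kernel-checked without importing another node. [cite: CornutVatsal2005, Thm. 1.10 (shape)] -/
@[conjecture]
def GlobalHeegnerIndivisibleMultOfParamAtThree : Prop :=
    ∀ (W' : WeierstrassCurve ℚ) [W'.IsElliptic] [W'.IsGloballyMinimal] (N' : ℕ) [NeZero N']
      (K : Type) [Field K] [NumberField K] (_Dt' : ModularParametrizationData W' N'),
      Rank1Residual.Mult W' 3 → ¬ 3 ∣ padicValInt 3 W'.minimalDiscriminantInt →
      W'.HasSurjectiveModNGaloisRep 3 → W'.conductorNorm ℤ = N' → IsImaginaryQuadratic K →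
      SatisfiesHeegnerHypothesis N' K → Odd (NumberField.discr K) →
      ∀ (κ : ZpExtension K 3), κ.IsAnticyclotomic →
      ∀ (𝔭 : HeightOneSpectrum (𝓞 K)), ((3 : ℕ) : 𝓞 K) ∈ 𝔭.asIdeal →
        𝔭.asIdeal.ramificationIdx (𝓞 ℚ) = 1 → 𝔭.asIdeal.inertiaDeg (𝓞 ℚ) = 1 →
      ∃ (jbar : AlgebraicClosure K →+* ℂ) (Dt : ModularParametrizationData W' N') (β : ℤ)
        (_ : (4 * N' : ℤ) ∣ β ^ 2 - NumberField.discr K) (k : ℕ)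
        (x : geomPoints (W'.baseChange K)) (R : Finset (absoluteGaloisGroup K)),
        complexPoint W' jbar x = heegnerPointComplexOfConductor Dt (NumberField.discr K) β (3 ^ (k + 1)) ∧
        (↑R ⊆ (κ.layerSubgroup k : Set (absoluteGaloisGroup K))) ∧
        (∀ τ ∈ κ.layerSubgroup k, ∃! r, r ∈ R ∧ r⁻¹ * τ ∈ ringClassSubgroup K (3 ^ (k + 1)) jbar) ∧
        ∀ (P : geomPoints (W'.baseChange K)), (∀ σ ∈ κ.layerSubgroup k, σ • P = P) →
          (3 : ℤ) • P ≠ ∑ r ∈ R, r • x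

/-- **S1 ∧ J ⟹ (G)‴** (PROVED): take one Kolyvagin prime `ℓ` (S1), its prime `w = ℓ𝓞_K`, the data of J; a point fixed by
all of `Γ_{K_k}` is fixed by `Γ_{K_k} ⊓ g D_w g⁻¹`, so local indivisibility at `w` gives global indivisibility.  Hence the
Jochnowitz road is a THIRD source of (G)‴ (besides K1‴ via `FineSelmerCut.global_of_principalHeegnerIndivisible` and
Cornut–Vatsal), independent of the explicit reciprocity law at `𝔭 ∣ 3`. [cite: Vatsal2003SpecialValues, Thm. 1.4 (shape of the inference)] -/
theorem global_of_kolyvaginLocal (hS : KolyvaginPrimeSupplyAtThree) (hJ : KolyvaginLocalIndivisibleMultAtThree) :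
    GlobalHeegnerIndivisibleMultOfParamAtThree := by
  intro W' _ _ N' _ K _ _ Dt' hm htr hsurj hN hK hH hodd κ hκ 𝔭 h𝔭 he hf
  obtain ⟨ℓ, -, hℓ⟩ := hS W' N' K hsurj hN hK 𝔭 h𝔭 he hf 0
  have hℓP : (Ideal.span {(ℓ : 𝓞 K)}).IsPrime := hℓ.2.2.1
  have hne : Ideal.span {(ℓ : 𝓞 K)} ≠ ⊥ := by
    rw [Ne, Ideal.span_singleton_eq_bot]
    exact_mod_cast hℓ.1.ne_zero
  let w : HeightOneSpectrum (𝓞 K) := ⟨Ideal.span {(ℓ : 𝓞 K)}, hℓP, hne⟩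
  have hw : (ℓ : 𝓞 K) ∈ w.asIdeal := Ideal.mem_span_singleton_self _
  obtain ⟨jbar, Dt, β, hβ, k, x, R, g, hx, hR, huniq, hind⟩ :=
    hJ W' N' K Dt' hm htr hsurj hN hK hH hodd κ hκ ℓ hℓ w hw
  exact ⟨jbar, Dt, β, hβ, k, x, R, hx, hR, huniq,
    fun P hP ↦ hind P fun σ hσ ↦ hP σ (Subgroup.mem_inf.mp hσ).1⟩

set_option synthInstance.maxHeartbeats 80000 in
set_option maxHeartbeats 1600000 in
/-- **Bucket B of crux 24737 from K1‴ and the engine-agnostic K2♭** — VERBATIM `UnipotentBipartite.twinAlgMuZeroAtThree_mult_of_howardConclusionFlat`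
(row 12), itself the v19 chain `twinAlgMuZeroAtThree_mult_of_betaRoadParam` with `residualCorankLeOneMult_of_ksTwinLambda`
replaced by K2♭ + `twin_k2Res_of_conclusion_of_layerIndivisible` (p766849): K1(𝔭) · degree one of `𝔭′` · K1(𝔭′) ·
K2_res · P_res (`BetaRoad.stub_residualLinkMult`, landed p745706) · `isTorsion_and_exists_generator_of_finite_pTorsion`.
[cite: Howard2004HeegnerKolyvagin, Thm. B, Thm. 2.3.1] [cite: GreenbergLNM1716, §1] -/
theorem twinAlgMuZeroAtThree_mult_of_howardConclusionFlat
    (hK1 : UniversalToricDescentBetaRoadParamDefs.PrincipalHeegnerIndivisibleMultOfParamAtThree)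
    (hK2 : HowardConclusionOfFamilyMultAtThree)
    (W' : WeierstrassCurve ℚ) [W'.IsElliptic] [W'.IsGloballyMinimal] (N' : ℕ) [NeZero N']
    (K : Type) [Field K] [NumberField K] (Dt' : ModularParametrizationData W' N')
    (hm : Rank1Residual.Mult W' 3) (htr : ¬ 3 ∣ padicValInt 3 W'.minimalDiscriminantInt)
    (hsurj : W'.HasSurjectiveModNGaloisRep 3) (hN : W'.conductorNorm ℤ = N') (hK : IsImaginaryQuadratic K)
    (hH : SatisfiesHeegnerHypothesis N' K) (hodd : Odd (NumberField.discr K))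
    (κ : ZpExtension K 3) (hκ : κ.IsAnticyclotomic)
    (γ : absoluteGaloisGroup K) [hγ : Fact (κ.IsTopGenerator γ)]
    (𝔭 : HeightOneSpectrum (𝓞 K)) (h𝔭 : ((3 : ℕ) : 𝓞 K) ∈ 𝔭.asIdeal)
    (he : 𝔭.asIdeal.ramificationIdx (𝓞 ℚ) = 1) (hf : 𝔭.asIdeal.inertiaDeg (𝓞 ℚ) = 1)
    (𝔭' : HeightOneSpectrum (𝓞 K)) (h𝔭' : ((3 : ℕ) : 𝓞 K) ∈ 𝔭'.asIdeal) (hne : 𝔭' ≠ 𝔭) :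
    Module.IsTorsion (IwasawaAlgebra 3) (XAc (W'.baseChange K) 3 κ 𝔭' ∅ γ) ∧
      ∃ g' : UnrSeries 3,
        (XAc.charIdeal (W'.baseChange K) 3 κ 𝔭' ∅ γ).map (PowerSeries.map (Halves.toUnr 3)) =
            Ideal.span {g'} ∧
          ∃ i : ℕ, ‖((PowerSeries.coeff i g' : unrIntegers 3) : ℂ_[3])‖ = 1 := by
  -- K1 at `𝔭` (from K1‴ and `Dt'`)
  obtain ⟨jbar, F, α, hα, hcoh, k, hk⟩ :=
    coherentBetaMult_of_principalIndivisibleOfParam hK1 W' N' K Dt' hm htr hsurj hN hK hH hodd κ hκ γ 𝔭 h𝔭 he hf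
  -- `𝔭′` is of degree one: `3 ∣ N′` (multiplicative) and `K` is Heegner for `N′`
  have h3N : (3 : ℕ) ∣ N' := hN ▸ dvd_conductorNorm_of_mult hm
  obtain ⟨he', hf'⟩ := degreeOne_of_dvd_of_heegner (p := 3) hK hH h3N h𝔭'
  -- K1 at `𝔭′` (from K1‴ and `Dt'`)
  obtain ⟨jbar', F', α', hα', hcoh', k', hk'⟩ :=
    coherentBetaMult_of_principalIndivisibleOfParam hK1 W' N' K Dt' hm htr hsurj hN hK hH hodd κ hκ γ 𝔭' h𝔭' he' hf'
  -- K2♭: the datum, the class, Howard's conclusion at its control levels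
  obtain ⟨Dat, z, hz, hconc⟩ := hK2 W' N' K hm htr hsurj hN hK hH hodd κ hκ γ 𝔭 h𝔭 he hf jbar F α hα hcoh ⟨k, hk⟩
  -- K1 at precision `3 = 3^1`
  have hK1' : ∃ k : ℕ, ∀ (Q : geomPoints (W'.baseChange K))
      (hQ : ∀ σ ∈ κ.layerSubgroup k ⊓ decomp 𝔭, σ • ((((3 : ℕ) : ℤ) ^ 1) • Q) = (((3 : ℕ) : ℤ) ^ 1) • Q),
      (((3 : ℕ) : ℤ) ^ 1) • Q = F.z k →
        (W'.baseChange K).kummerClassOver (κ.layerSubgroup k ⊓ decomp 𝔭) (((3 : ℕ) : ℤ) ^ 1) Q hQ ≠ 0 := by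
    have e31 : (((3 : ℕ) : ℤ) ^ 1) = 3 := by norm_num
    rw [e31]
    exact ⟨k, hk⟩
  -- K2_res (p766849)
  obtain ⟨C, hC⟩ :=
    UniversalToricDescentTwinK2ResOfConclusion.twin_k2Res_of_conclusion_of_layerIndivisible
      W' N' K hm hsurj hK hH κ hκ γ F hα Dat hz (decomp 𝔭) hK1' hconc
  -- P_res: the residual two-sided link (landed)
  have hfin : Set.Finite {s : selmerAc (W'.baseChange K) 3 κ 𝔭' ∅ | 3 • s = 0} :=
    Summit.BirchSwinnertonDyer.BirchSwinnertonDyer.Cruxes.TwinAlgMuZeroAtThree.BetaRoad.stub_residualLinkMult W' N' K hm htr hsurj hN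
      hK hH κ hκ γ 𝔭 h𝔭 he hf 𝔭' h𝔭' hne jbar F α k hα hcoh hk jbar' F' α' k' hα' hcoh' hk' C hC
  -- the landed receptacle
  haveI : (W'.baseChange K).IsElliptic := by rw [WeierstrassCurve.baseChange]; infer_instance
  exact isTorsion_and_exists_generator_of_finite_pTorsion (W'.baseChange K) 3 κ 𝔭' ∅ γ Set.finite_empty hfin

/-- **The crux BY NAME** from the node's pieces: bucket B via K1‴ + (S0, S1, J ⟹ K2♭ by the signed bipartite stub) + the
landed residual chain; bucket C₀ via C₀′ BY NAME.  Mirrors `twinAlgMuZeroAtThree_of_betaRoadParamStubs` (v19). -/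
theorem TwinAlgMuZeroAtThree_of :
    Summit.BirchSwinnertonDyer.BirchSwinnertonDyer.Theses.UniversalToricDescent.TwinAlgMuZeroAtThree := by
  intro W' _ _ N' _ K _ _ Dt' hbucket hsurj hN hK hH hodd κ hκ γ _ 𝔭 h𝔭 he hf 𝔭' h𝔭' hne
  rcases hbucket with ⟨hm, htr⟩ | ⟨hss, ha⟩
  · exact twinAlgMuZeroAtThree_mult_of_howardConclusionFlat stub_principalHeegnerIndivisibleMult
      (stub_bisignedBipartiteHowardConclusion Instrument.bisignedLocalSymplectic stub_kolyvaginSupply stub_bisignedJochnowitzLocal)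
      W' N' K Dt' hm htr hsurj hN hK hH hodd κ hκ γ 𝔭 h𝔭 he hf 𝔭' h𝔭' hne
  · exact (UniversalToricDescentBetaRoadParamDefs.twinAlgMuZeroAtThreeGoodSSOfParam_iff.mp stub_goodSS)
      W' N' K Dt' hss ha hsurj hN hK hH hodd κ hκ γ 𝔭 h𝔭 he hf 𝔭' h𝔭' hne

/-! ## 3. Sanity: beta-road's K2a‴ still implies K2♭ (this node offers an ALTERNATIVE engine for the same slot), and K1‴ ⟹ (G)‴ -/

/-- K2a‴ ⟹ K2♭ (tree theorem `howardConclusionOfFamily_of_ksTwinLambda`). -/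
theorem howardConclusionFlat_of_ksTwinLambda (hK2 : UniversalToricDescentKsTwinLambdaDefs.KsTwinLambdaAdicAtThree) :
    HowardConclusionOfFamilyMultAtThree := by
  intro W' _ _ N' _ K _ _ hm htr hsurj hN hK hH hodd κ hκ γ hγ 𝔭 h𝔭 he hf jbar F α hα hcoh hK1
  exact howardConclusionOfFamily_of_ksTwinLambda hK2 W' N' K hm htr hsurj hN hK hH hodd κ hκ γ 𝔭 h𝔭 he hf jbar F α hα hcoh hK1

/-- K1‴ ⟹ (G)‴ (as in row 8): so (G)‴ has the two sources K1‴ and S1 ∧ J in this file. -/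
theorem global_of_principalHeegnerIndivisible
    (hK1 : UniversalToricDescentBetaRoadParamDefs.PrincipalHeegnerIndivisibleMultOfParamAtThree) :
    GlobalHeegnerIndivisibleMultOfParamAtThree := by
  intro W' _ _ N' _ K _ _ Dt' hm htr hsurj hN hK hH hodd κ hκ 𝔭 h𝔭 he hf
  obtain ⟨jbar, Dt, β, hβ, k, x, R, hx, hR, huniq, hind⟩ :=
    (UniversalToricDescentBetaRoadParamDefs.principalHeegnerIndivisibleMultOfParamAtThree_iff.mp hK1)
      W' N' K Dt' hm htr hsurj hN hK hH hodd κ hκ 𝔭 h𝔭 he hf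
  exact ⟨jbar, Dt, β, hβ, k, x, R, hx, hR, huniq,
    fun P hP ↦ hind P fun σ hσ ↦ hP σ (Subgroup.mem_inf.mp hσ).1⟩

end Summit.BirchSwinnertonDyer.BirchSwinnertonDyer.Cruxes.TwinAlgMuZeroAtThree.BisignedKolyvaginPrimes

end
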